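import Literature.Analysis.InverseSpectral.KreinString
import HarnessLib

/-!
# Stieltjes data: the constant `b` as a limit

For a function with a Stieltjes representation `q(z) = b + ∫_{[0,∞)} dσ(λ)/(λ - z)`
(`HasStieltjesRepresentation`, `∫ dσ/(1+λ) < ∞`) the constant is recovered as
`b = lim_{s → +∞} q(-s)` (`tendsto_apply_neg_atTop`), so it is uniquely determined by `q`
(`stieltjes_const_unique`). (Kac–Kreĭn 1974, Supplement I §S1.5; for a string `b` is the length of
the initial mass-free segment, Tomisaki 1988 §4.)

## References

KacKrein1974 (Supplement I §S1.5), Tomisaki1988 (§4).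
-/

open MeasureTheory Filter Set Topology
open scoped ENNReal

noncomputable section

namespace Literature.Analysis.InverseSpectral

/-- The weight `(1 + t)⁻¹` is `σ`-integrable for Stieltjes data `σ`. [folklore] -/
lemma integrable_inv_one_add_of_hasStieltjesRepresentation {q : ℂ → ℂ} {b : ℝ} {σ : Measure ℝ}
    (h : HasStieltjesRepresentation q b σ) : Integrable (fun t : ℝ => (1 + t)⁻¹) σ := by
  obtain ⟨-, hσ0, hfin, -⟩ := h
  have hae : ∀ᵐ t ∂σ, (0 : ℝ) ≤ t := by
    rw [ae_iff]
    have hset : {a : ℝ | ¬0 ≤ a} = Iio 0 := by ext a; simp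
    rw [hset]; exact hσ0
  refine ⟨(measurable_const.add measurable_id).inv.aestronglyMeasurable, ?_⟩
  rw [hasFiniteIntegral_iff_enorm]
  calc ∫⁻ t, ‖(1 + t)⁻¹‖ₑ ∂σ = ∫⁻ t, ENNReal.ofReal (1 + t)⁻¹ ∂σ := by
        refine lintegral_congr_ae ?_
        filter_upwards [hae] with t ht
        exact Real.enorm_eq_ofReal (by positivity)
    _ < ⊤ := hfin

/-- **`b = lim_{s→∞} q(-s)`** for Stieltjes data `(b, σ)` of `q` (dominated convergence:
`∫ dσ(λ)/(λ + s) → 0`). [cite: KacKrein1974, Supplement I §S1.5] -/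
theorem tendsto_apply_neg_atTop {q : ℂ → ℂ} {b : ℝ} {σ : Measure ℝ}
    (h : HasStieltjesRepresentation q b σ) :
    Tendsto (fun s : ℝ => q (-(s : ℂ))) atTop (𝓝 (b : ℂ)) := by
  have hint := integrable_inv_one_add_of_hasStieltjesRepresentation h
  obtain ⟨-, hσ0, -, hrep⟩ := h
  have hae : ∀ᵐ t ∂σ, (0 : ℝ) ≤ t := by
    rw [ae_iff]
    have hset : {a : ℝ | ¬0 ≤ a} = Iio 0 := by ext a; simp
    rw [hset]; exact hσ0
  -- `q(-s) = b + ∫ (t + s)⁻¹ dσ` for `s > 0`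
  have heq : ∀ᶠ s : ℝ in atTop, (b : ℂ) + ∫ t : ℝ, ((t : ℂ) - (-(s : ℂ)))⁻¹ ∂σ = q (-(s : ℂ)) := by
    filter_upwards [eventually_gt_atTop (0 : ℝ)] with s hs
    exact (hrep (-(s : ℂ)) (Or.inr (by simpa using hs))).symm
  refine Tendsto.congr' heq ?_
  have hlim : Tendsto (fun s : ℝ => ∫ t : ℝ, ((t : ℂ) - (-(s : ℂ)))⁻¹ ∂σ) atTop (𝓝 0) := by
    have h0 : (0 : ℂ) = ∫ _ : ℝ, (0 : ℂ) ∂σ := by simp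
    rw [h0]
    refine tendsto_integral_filter_of_dominated_convergence (fun t => (1 + t)⁻¹) ?_ ?_ hint ?_
    · exact Eventually.of_forall (fun s =>
        ((Complex.measurable_ofReal.sub_const _).inv).aestronglyMeasurable)
    · filter_upwards [eventually_ge_atTop 1] with s hs
      filter_upwards [hae] with t ht
      have hts : (t : ℂ) - (-(s : ℂ)) = ((t + s : ℝ) : ℂ) := by push_cast; ring
      rw [hts, norm_inv, Complex.norm_real, Real.norm_eq_abs, abs_of_pos (by linarith)]
      exact inv_anti₀ (by linarith) (by linarith)
    · filter_upwards [hae] with t ht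
      have hts : ∀ s : ℝ, ((t : ℂ) - (-(s : ℂ)))⁻¹ = (((t + s)⁻¹ : ℝ) : ℂ) := fun s => by
        push_cast; ring
      simp_rw [hts]
      rw [show (0 : ℂ) = ((0 : ℝ) : ℂ) from Complex.ofReal_zero.symm]
      refine (Complex.continuous_ofReal.tendsto 0).comp ?_
      exact tendsto_inv_atTop_zero.comp (tendsto_atTop_add_const_left atTop t tendsto_id)
  simpa using tendsto_const_nhds.add hlim

/-- **Uniqueness of the Stieltjes constant**: two Stieltjes representations of the same function
have the same constant `b`. [cite: KacKrein1974, Supplement I §S1.5] -/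
theorem stieltjes_const_unique {q : ℂ → ℂ} {b₁ b₂ : ℝ} {σ₁ σ₂ : Measure ℝ}
    (h₁ : HasStieltjesRepresentation q b₁ σ₁) (h₂ : HasStieltjesRepresentation q b₂ σ₂) :
    b₁ = b₂ := by
  have h := tendsto_nhds_unique (tendsto_apply_neg_atTop h₁) (tendsto_apply_neg_atTop h₂)
  exact_mod_cast h

namespace KreinString

/-- For a Kreĭn string whose principal Titchmarsh–Weyl function lies in `N_S`, the Weyl constant is
the limit of `q_S(-s)` as `s → +∞`. [cite: Tomisaki1988, §4] -/
theorem tendsto_principalWeylFunction_neg_atTop (S : KreinString)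
    (h : IsNevanlinnaStieltjes S.principalWeylFunction) :
    Tendsto (fun s : ℝ => S.principalWeylFunction (-(s : ℂ))) atTop (𝓝 (S.weylConstant : ℂ)) :=
  tendsto_apply_neg_atTop (S.hasStieltjesRepresentation_spectralMeasure h)

end KreinString

end Literature.Analysis.InverseSpectral

end
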